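import Summits.KontsevichZagierPeriods.Zeta5Search.Certificates.RecordRayDenominators
import Literature.NumberTheory.DiophantineApproximation.DilogLandenLinearIndependenceRates
import HarnessLib

/-!
# ζ(5) search — the record ray's DENOMINATORS, II: the size of the baseline multiplier and the FIRST hypothesis-free exponent (TYPER g15)

HONEST FRAMING: systematic search; no irrationality claim unless certified.

OUR work (Summit side; typer seat, generation 15).  Sequel of `RecordRayDenominators`.  The baseline multiplier
`M0 n = d_{41n}⁹·N♯(b)N♯(b′)/|ρ(a·n)|` of the record ray is a BALANCED factorial ratio times `d_{41n}⁹`: the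
`n log n` terms of `N♯(b)N♯(b′)` (`2·81·n`) and of `|ρ(a·n)|` (`192n − 92n` … with the `(b₂!b₃!)²` correction,
`254n` on both sides) cancel, and Robbins–Stirling (`RecordRayStirling.log_factorial_mul_bounds`) with the certified
logarithms of `Certificates/LogEnclosures*` gives

* `log_sharpRatio_le` — `log(N♯(b)·N♯(b′)/|ρ(a·n)|) ≤ 12.5232·n + 5·log(176 n) + 3` for `n ≥ 1`
  (true linear rate `S = −8log8 − 9log9 − 20log10 − 11log11 + 12log12 + 52log13 + 56log14 − 15log15 − 64log16 − 18log18 + 25log25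
  = 12.52313`);
* `eventually_M0_le_exp` — with the prime number theorem for `d_{41n}` (`ViolaZudilin.tendsto_log_lcmUpto_mul_div`):
  **for every `ε > 0`, eventually `M0 n ≤ e^{(381.5232 + ε)·n}`** (`9·41 + 12.5232`);
* `record_exponent_baseline` — plugging `M0` into `record_exponent_rat`: **hypothesis-free**, for every `γ ≤ 0.2499`,
  eventually `|ζ(5) − P_n/Q(a·n)| < 1/q_n^γ` with the integers `p_n = M0 n·P_n`, `q_n = M0 n·|Q(a·n)|`.
  This is the cell's first kernel exponent for the record approximations with NO open input; its value is poor
  (Brown–Zudilin print `0.86` from the OBSERVED denominators (28)–(30); the census's engine columns give `0.78`/`0.86`)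
  because `M0` removes no prime: the window files of this series (`RecordRayDenominatorsWindows*`) divide `M0` by
  certified prime-window powers and raise `γ` step by step.  No irrationality content (`γ < 1`).
-/

noncomputable section

open Finset Real Filter Topology

namespace Summit.KontsevichZagierPeriods.Zeta5Search.RecordRay

open Summit.KontsevichZagierPeriods.Zeta5Search.DualSeries
open Summit.KontsevichZagierPeriods.Zeta5Search.DualSeriesDenominators
open Summit.KontsevichZagierPeriods.Zeta5Search.WedgeDictionary
open Summit.KontsevichZagierPeriods.Zeta5Search.DualSeriesLemma19 (bRecord)
open Summit.KontsevichZagierPeriods.Zeta5Search.LogEnclosures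
open Literature.NumberTheory.Transcendental (zetaValue)

/-! ### The normalisers on the ray, in factorials -/

/-- The six block factorials of `N(bRecord n)`: `(12n)!, (13n)!, (14n)!, (15n)!, (14n)!, (13n)!`. -/
theorem normaliser_bRecord (n : ℕ) :
    normaliser (bRecord n) = (12 * n).factorial * (13 * n).factorial * (14 * n).factorial * (15 * n).factorial *
      (14 * n).factorial * (13 * n).factorial := by
  have h0 := bn_bRecord_zero n
  have h1 := bn_bRecord_slot n (j := 1) (by norm_num) (by norm_num)
  have h2 := bn_bRecord_slot n (j := 2) (by norm_num) (by norm_num)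
  have h3 := bn_bRecord_slot n (j := 3) (by norm_num) (by norm_num)
  have h4 := bn_bRecord_slot n (j := 4) (by norm_num) (by norm_num)
  have h5 := bn_bRecord_slot n (j := 5) (by norm_num) (by norm_num)
  have h6 := bn_bRecord_slot n (j := 6) (by norm_num) (by norm_num)
  have h7 := bn_bRecord_slot n (j := 7) (by norm_num) (by norm_num)
  have e0 : blockLen (bRecord n) 0 - 1 = 12 * n := by simp only [blockLen, pfst, psnd, h0, h1, h6]; omega
  have e1 : blockLen (bRecord n) 1 - 1 = 13 * n := by simp only [blockLen, pfst, psnd, h0, h1, h7]; omega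
  have e2 : blockLen (bRecord n) 2 - 1 = 14 * n := by simp only [blockLen, pfst, psnd, h0, h2, h7]; omega
  have e3 : blockLen (bRecord n) 3 - 1 = 15 * n := by simp only [blockLen, pfst, psnd, h0, h6, h4]; omega
  have e4 : blockLen (bRecord n) 4 - 1 = 14 * n := by simp only [blockLen, pfst, psnd, h0, h4, h5]; omega
  have e5 : blockLen (bRecord n) 5 - 1 = 13 * n := by simp only [blockLen, pfst, psnd, h0, h5, h3]; omega
  simp only [normaliser, prod_range_succ, prod_range_zero, one_mul, e0, e1, e2, e3, e4, e5]

/-- The six block factorials of `N(bRecord' n)`: `(12n)!, (13n−1)!, (14n−1)!, (15n)!, (14n)!, (13n)!`. -/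
theorem normaliser_bRecord' (n : ℕ) :
    normaliser (bRecord' n) = (12 * n).factorial * (13 * n - 1).factorial * (14 * n - 1).factorial * (15 * n).factorial *
      (14 * n).factorial * (13 * n).factorial := by
  have h0 := bn_bRecord'_zero n
  have h1 := bn_bRecord'_slot n (j := 1) (by norm_num) (by norm_num)
  have h2 := bn_bRecord'_slot n (j := 2) (by norm_num) (by norm_num)
  have h3 := bn_bRecord'_slot n (j := 3) (by norm_num) (by norm_num)
  have h4 := bn_bRecord'_slot n (j := 4) (by norm_num) (by norm_num)
  have h5 := bn_bRecord'_slot n (j := 5) (by norm_num) (by norm_num)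
  have h6 := bn_bRecord'_slot n (j := 6) (by norm_num) (by norm_num)
  have h7 := bn_bRecord'_seven n
  have e0 : blockLen (bRecord' n) 0 - 1 = 12 * n := by simp only [blockLen, pfst, psnd, h0, h1, h6]; omega
  have e1 : blockLen (bRecord' n) 1 - 1 = 13 * n - 1 := by simp only [blockLen, pfst, psnd, h0, h1, h7]; omega
  have e2 : blockLen (bRecord' n) 2 - 1 = 14 * n - 1 := by simp only [blockLen, pfst, psnd, h0, h2, h7]; omega
  have e3 : blockLen (bRecord' n) 3 - 1 = 15 * n := by simp only [blockLen, pfst, psnd, h0, h6, h4]; omega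
  have e4 : blockLen (bRecord' n) 4 - 1 = 14 * n := by simp only [blockLen, pfst, psnd, h0, h4, h5]; omega
  have e5 : blockLen (bRecord' n) 5 - 1 = 13 * n := by simp only [blockLen, pfst, psnd, h0, h5, h3]; omega
  simp only [normaliser, prod_range_succ, prod_range_zero, one_mul, e0, e1, e2, e3, e4, e5]

/-- `N♯(bRecord n)` in factorials (over `ℝ`). -/
theorem sharpNormaliser_bRecord (n : ℕ) :
    ((sharpNormaliser (bRecord n) : ℚ) : ℝ) =
      ((((12 * n).factorial : ℕ) : ℝ) * (((13 * n).factorial : ℕ) : ℝ) * (((14 * n).factorial : ℕ) : ℝ) *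
        (((15 * n).factorial : ℕ) : ℝ) * (((14 * n).factorial : ℕ) : ℝ) * (((13 * n).factorial : ℕ) : ℝ)) /
      ((((16 * n).factorial : ℕ) : ℝ) * (((15 * n).factorial : ℕ) : ℝ)) := by
  have h2 := bn_bRecord_slot n (j := 2) (by norm_num) (by norm_num)
  have h3 := bn_bRecord_slot n (j := 3) (by norm_num) (by norm_num)
  simp only [sharpNormaliser, normaliser_bRecord, h2, h3]
  push_cast
  ring

/-- `N♯(bRecord' n) ≤ N♯(bRecord n)`-shape bound in factorials (over `ℝ`): `(13n−1)! ≤ (13n)!`, `(14n−1)! ≤ (14n)!`. -/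
theorem sharpNormaliser_bRecord'_le (n : ℕ) :
    ((sharpNormaliser (bRecord' n) : ℚ) : ℝ) ≤
      ((((12 * n).factorial : ℕ) : ℝ) * (((13 * n).factorial : ℕ) : ℝ) * (((14 * n).factorial : ℕ) : ℝ) *
        (((15 * n).factorial : ℕ) : ℝ) * (((14 * n).factorial : ℕ) : ℝ) * (((13 * n).factorial : ℕ) : ℝ)) /
      ((((16 * n).factorial : ℕ) : ℝ) * (((15 * n).factorial : ℕ) : ℝ)) := by
  have h2 := bn_bRecord'_slot n (j := 2) (by norm_num) (by norm_num)
  have h3 := bn_bRecord'_slot n (j := 3) (by norm_num) (by norm_num)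
  simp only [sharpNormaliser, normaliser_bRecord', h2, h3]
  push_cast
  have ha : (((13 * n - 1).factorial : ℕ) : ℝ) ≤ (((13 * n).factorial : ℕ) : ℝ) := by
    exact_mod_cast Nat.factorial_le (Nat.sub_le _ _)
  have hb : (((14 * n - 1).factorial : ℕ) : ℝ) ≤ (((14 * n).factorial : ℕ) : ℝ) := by
    exact_mod_cast Nat.factorial_le (Nat.sub_le _ _)
  have hF : ∀ m : ℕ, (0 : ℝ) < ((m.factorial : ℕ) : ℝ) := fun m => by positivity
  rw [div_le_div_iff_of_pos_right (mul_pos (hF _) (hF _))]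
  have := hF (12 * n); have := hF (15 * n); have := hF (14 * n); have := hF (13 * n)
  have := hF (13 * n - 1); have := hF (14 * n - 1)
  gcongr

/-! ### The balanced ratio `N♯(b)N♯(b′)/|ρ|` -/

/-- Shorthand: `L c n = log (c·n)!`. -/
def L (c n : ℕ) : ℝ := Real.log (((c * n).factorial : ℕ) : ℝ)

set_option maxHeartbeats 1000000 in
/-- **The Stirling combination**: the linear combination of `log (c n)!` that is `log(N♯(b)²·4/|ρ(a·n)|) − log 4`
(coefficients `L12 + 4·L13 + 4·L14 + L25 − L8 − L9 − 2L10 − L11 − L15 − 4L16 − L18`, the `L17` cancelling) is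
`≤ 12.5232·n + 5·log(176 n) + 8/5` for `n ≥ 1` (the `n log n` terms cancel: `12+52+56+25 = 8+9+20+11+15+64+18`). -/
theorem stirling_combination_le {n : ℕ} (hn : 1 ≤ n) :
    L 12 n + 4 * L 13 n + 4 * L 14 n + L 25 n - L 8 n - L 9 n - 2 * L 10 n - L 11 n - L 15 n - 4 * L 16 n - L 18 n
      ≤ 125232 / 10000 * n + 5 * Real.log (176 * n) + 8 / 5 := by
  have hnR : (1 : ℝ) ≤ n := by exact_mod_cast hn
  unfold L
  -- Stirling bounds: upper for positive coefficients (12, 13, 14, 25), lower for negative ones (8, 9, 10, 11, 15, 16, 18)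
  have u12 := (log_factorial_mul_bounds (c := 12) (by norm_num) hn).2
  have u13 := (log_factorial_mul_bounds (c := 13) (by norm_num) hn).2
  have u14 := (log_factorial_mul_bounds (c := 14) (by norm_num) hn).2
  have u25 := (log_factorial_mul_bounds (c := 25) (by norm_num) hn).2
  have l8 := (log_factorial_mul_bounds (c := 8) (by norm_num) hn).1
  have l9 := (log_factorial_mul_bounds (c := 9) (by norm_num) hn).1
  have l10 := (log_factorial_mul_bounds (c := 10) (by norm_num) hn).1
  have l11 := (log_factorial_mul_bounds (c := 11) (by norm_num) hn).1
  have l15 := (log_factorial_mul_bounds (c := 15) (by norm_num) hn).1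
  have l16 := (log_factorial_mul_bounds (c := 16) (by norm_num) hn).1
  have l18 := (log_factorial_mul_bounds (c := 18) (by norm_num) hn).1
  -- slacks
  have s12 := stirling_slack_le (c := 12) (K := 176) hn (by norm_num) (by norm_num)
  have s13 := stirling_slack_le (c := 13) (K := 176) hn (by norm_num) (by norm_num)
  have s14 := stirling_slack_le (c := 14) (K := 176) hn (by norm_num) (by norm_num)
  have s25 := stirling_slack_le (c := 25) (K := 176) hn (by norm_num) (by norm_num)
  -- logarithms
  obtain ⟨a8, b8⟩ := log_8_bounds
  obtain ⟨a9, b9⟩ := log_9_bounds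
  obtain ⟨a10, b10⟩ := log_10_bounds
  obtain ⟨a11, b11⟩ := log_11_bounds
  obtain ⟨a12, b12⟩ := log_12_bounds
  obtain ⟨a13, b13⟩ := log_13_bounds
  obtain ⟨a14, b14⟩ := log_14_bounds
  obtain ⟨a15, b15⟩ := log_15_bounds
  obtain ⟨a16, b16⟩ := log_16_bounds
  obtain ⟨a18, b18⟩ := log_18_bounds
  obtain ⟨a25, b25⟩ := log_25_bounds
  have hn0 : (0 : ℝ) ≤ n := by linarith
  have hlogn : 0 ≤ Real.log n := Real.log_nonneg hnR
  have hL : 0 ≤ Real.log (176 * (n : ℝ)) := Real.log_nonneg (by linarith)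
  -- multiply the certified logarithm bounds by n (with the sign of the coefficient)
  have m12 : (12 * Real.log 12 - 12) * (n : ℝ) ≤ (12 * (2484906649788000373 / 1000000000000000000 : ℝ) - 12) * n :=
    mul_le_mul_of_nonneg_right (by linarith) hn0
  have m13 : (13 * Real.log 13 - 13) * (n : ℝ) ≤ (13 * (2564949357461536799 / 1000000000000000000 : ℝ) - 13) * n :=
    mul_le_mul_of_nonneg_right (by linarith) hn0
  have m14 : (14 * Real.log 14 - 14) * (n : ℝ) ≤ (14 * (1319528664807629341 / 500000000000000000 : ℝ) - 14) * n :=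
    mul_le_mul_of_nonneg_right (by linarith) hn0
  have m25 : (25 * Real.log 25 - 25) * (n : ℝ) ≤ (25 * (804718956217050207 / 250000000000000000 : ℝ) - 25) * n :=
    mul_le_mul_of_nonneg_right (by linarith) hn0
  have k8 : (8 * (2079441541679835891 / 1000000000000000000 : ℝ) - 8) * (n : ℝ) ≤ (8 * Real.log 8 - 8) * n :=
    mul_le_mul_of_nonneg_right (by linarith) hn0
  have k9 : (9 * (137326536083513709 / 62500000000000000 : ℝ) - 9) * (n : ℝ) ≤ (9 * Real.log 9 - 9) * n :=
    mul_le_mul_of_nonneg_right (by linarith) hn0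
  have k10 : (10 * (575646273248511411 / 250000000000000000 : ℝ) - 10) * (n : ℝ) ≤ (10 * Real.log 10 - 10) * n :=
    mul_le_mul_of_nonneg_right (by linarith) hn0
  have k11 : (11 * (2397895272798370499 / 1000000000000000000 : ℝ) - 11) * (n : ℝ) ≤ (11 * Real.log 11 - 11) * n :=
    mul_le_mul_of_nonneg_right (by linarith) hn0
  have k15 : (15 * (2708050201102210019 / 1000000000000000000 : ℝ) - 15) * (n : ℝ) ≤ (15 * Real.log 15 - 15) * n :=
    mul_le_mul_of_nonneg_right (by linarith) hn0
  have k16 : (16 * (693147180559945297 / 250000000000000000 : ℝ) - 16) * (n : ℝ) ≤ (16 * Real.log 16 - 16) * n :=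
    mul_le_mul_of_nonneg_right (by linarith) hn0
  have k18 : (18 * (2890371757896164641 / 1000000000000000000 : ℝ) - 18) * (n : ℝ) ≤ (18 * Real.log 18 - 18) * n :=
    mul_le_mul_of_nonneg_right (by linarith) hn0
  push_cast at *
  linarith [mul_nonneg hn0 hlogn]

set_option maxHeartbeats 1000000 in
/-- `log` of the explicit factorial ratio `N♯(b)·N♯(b)/|ρ(a·n)|` (everything written in factorials) as the Stirling
combination plus `log 4` (bookkeeping: `log` of products and quotients of positive reals). -/
theorem log_ratio_eq (n : ℕ) :
    Real.log ((((((12 * n).factorial : ℕ) : ℝ) * (((13 * n).factorial : ℕ) : ℝ) * (((14 * n).factorial : ℕ) : ℝ) * (((15 * n).factorial : ℕ) : ℝ) * (((14 * n).factorial : ℕ) : ℝ) * (((13 * n).factorial : ℕ) : ℝ)) / ((((16 * n).factorial : ℕ) : ℝ) * (((15 * n).factorial : ℕ) : ℝ))) * (((((12 * n).factorial : ℕ) : ℝ) * (((13 * n).factorial : ℕ) : ℝ) * (((14 * n).factorial : ℕ) : ℝ) * (((15 * n).factorial : ℕ) : ℝ) * (((14 * n).factorial : ℕ) : ℝ) *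 (((13 * n).factorial : ℕ) : ℝ)) / ((((16 * n).factorial : ℕ) : ℝ) * (((15 * n).factorial : ℕ) : ℝ))) / (((((8 * n).factorial : ℕ) : ℝ) * (((9 * n).factorial : ℕ) : ℝ) * (((10 * n).factorial : ℕ) : ℝ) * (((11 * n).factorial : ℕ) : ℝ) * (((10 * n).factorial : ℕ) : ℝ) * (((11 * n).factorial : ℕ) : ℝ) * (((12 * n).factorial : ℕ) : ℝ) * (((13 * n).factorial : ℕ) : ℝ) * (((12 * n).factorial : ℕ) : ℝ) * (((14 * n).factorial : ℕ) : ℝ) * (((15 * n).factorial : ℕ) : ℝ) * (((16 * n).factorial : ℕ) : ℝ) * (((16 * n).factorial : ℕ) : ℝ) * (((17 * n).factorial : ℕ) : ℝ) * (((18 * n).factorial : ℕ) : ℝ)) / (4 * ((((17 * n).factorial : ℕ) : ℝ) * (((14 * n).factorial : ℕ) : ℝ) * (((13 * n).factorial : ℕ) : ℝ) * (((12 * n).factorial : ℕ) : ℝ) * (((11 * n).factorial : ℕ) : ℝ)) * (((25 * n).factorial : ℕ) : ℝ)))) =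
    (L 12 n + 4 * L 13 n + 4 * L 14 n + L 25 n - L 8 n - L 9 n - 2 * L 10 n - L 11 n - L 15 n - 4 * L 16 n - L 18 n)
      + Real.log 4 := by
  have hF : ∀ m : ℕ, (0 : ℝ) < ((m.factorial : ℕ) : ℝ) := fun m => by positivity
  unfold L
  simp only [Real.log_mul, Real.log_div, (hF _).ne', mul_ne_zero_iff, div_ne_zero_iff, ne_eq, not_false_eq_true,
    and_self, OfNat.ofNat_ne_zero]
  ring

set_option maxHeartbeats 400000 in
/-- **`log(N♯(b)·N♯(b′)/|ρ(a·n)|) ≤ 12.5232·n + 5·log(176 n) + 3`** for `n ≥ 1`. -/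
theorem log_sharpRatio_le {n : ℕ} (hn : 1 ≤ n) :
    Real.log (((sharpNormaliser (bRecord n) : ℚ) : ℝ) * ((sharpNormaliser (bRecord' n) : ℚ) : ℝ) /
        |(rhoOf (aRec n) : ℝ)|) ≤ 125232 / 10000 * n + 5 * Real.log (176 * n) + 3 := by
  have hF : ∀ m : ℕ, (0 : ℝ) < ((m.factorial : ℕ) : ℝ) := fun m => by positivity
  have hrho := abs_rhoOf_aRec n
  have hρpos : 0 < |(rhoOf (aRec n) : ℝ)| := by rw [hrho]; positivity
  have hN1 := sharpNormaliser_bRecord n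
  have hN2 := sharpNormaliser_bRecord'_le n
  have hN2pos : 0 < ((sharpNormaliser (bRecord' n) : ℚ) : ℝ) := by exact_mod_cast sharpNormaliser_pos _
  have hN1pos : 0 < ((sharpNormaliser (bRecord n) : ℚ) : ℝ) := by exact_mod_cast sharpNormaliser_pos _
  have hXpos : 0 < ((sharpNormaliser (bRecord n) : ℚ) : ℝ) * ((sharpNormaliser (bRecord' n) : ℚ) : ℝ) /
      |(rhoOf (aRec n) : ℝ)| := by positivity
  have hle : ((sharpNormaliser (bRecord n) : ℚ) : ℝ) * ((sharpNormaliser (bRecord' n) : ℚ) : ℝ) / |(rhoOf (aRec n) : ℝ)| ≤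
      ((sharpNormaliser (bRecord n) : ℚ) : ℝ) * ((((((12 * n).factorial : ℕ) : ℝ) * (((13 * n).factorial : ℕ) : ℝ) * (((14 * n).factorial : ℕ) : ℝ) * (((15 * n).factorial : ℕ) : ℝ) * (((14 * n).factorial : ℕ) : ℝ) * (((13 * n).factorial : ℕ) : ℝ)) / ((((16 * n).factorial : ℕ) : ℝ) * (((15 * n).factorial : ℕ) : ℝ)))) / |(rhoOf (aRec n) : ℝ)| := by
    gcongr
  refine (Real.log_le_log hXpos hle).trans ?_
  rw [hN1, hrho, log_ratio_eq n]
  have h1 := stirling_combination_le hn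
  have hlog4 : Real.log 4 ≤ 14 / 10 := by
    have : Real.log 4 = 2 * Real.log 2 := by
      rw [show (4 : ℝ) = 2 ^ 2 by norm_num, Real.log_pow]; norm_num
    rw [this]
    have h2 := Real.log_two_lt_d9
    linarith
  linarith

/-- `(M0 n : ℝ) = d_{41n}⁹ · (N♯(b)N♯(b′)/|ρ|)` over `ℝ`. -/
theorem cast_M0 (n : ℕ) : ((M0 n : ℚ) : ℝ) = ((Nat.lcmUpto (41 * n) : ℕ) : ℝ) ^ 9 *
    (((sharpNormaliser (bRecord n) : ℚ) : ℝ) * ((sharpNormaliser (bRecord' n) : ℚ) : ℝ) / |(rhoOf (aRec n) : ℝ)|) := by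
  unfold M0 dRec
  push_cast
  ring

/-- **Size of the baseline multiplier**: for every `ε > 0`, eventually `M0 n ≤ e^{(381.5232 + ε)·n}`
(`9·41` from `d_{41n}⁹` by the prime number theorem, `12.5232` from the balanced factorial ratio). -/
theorem eventually_M0_le_exp {ε : ℝ} (hε : 0 < ε) :
    ∀ᶠ n : ℕ in atTop, ((M0 n : ℚ) : ℝ) ≤ Real.exp ((3815232 / 10000 + ε) * n) := by
  have hε2 : 0 < ε / 2 := by positivity
  -- the lcm
  have hlcm : ∀ᶠ n : ℕ in atTop, Real.log ((Nat.lcmUpto (41 * n) : ℕ) : ℝ) ≤ (41 + ε / 18) * n := by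
    have h := Literature.NumberTheory.DiophantineApproximation.ViolaZudilin.tendsto_log_lcmUpto_mul_div (c := 41) (by norm_num)
    have h2 := (Metric.tendsto_atTop.1 h) (ε / 18) (by positivity)
    obtain ⟨N, hN⟩ := h2
    filter_upwards [eventually_ge_atTop (max N 1)] with n hn
    have hn1 : 1 ≤ n := le_trans (le_max_right _ _) hn
    have hnpos : (0 : ℝ) < n := by exact_mod_cast hn1
    have := hN n (le_trans (le_max_left _ _) hn)
    rw [Real.dist_eq] at this
    have h3 := (abs_lt.1 this).2
    push_cast at h3
    have h4 : Real.log ((Nat.lcmUpto (41 * n) : ℕ) : ℝ) / n < 41 + ε / 18 := by linarith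
    rw [div_lt_iff₀ hnpos] at h4
    linarith
  filter_upwards [hlcm, eventually_ge_atTop 1,
    eventually_log_linear_le (a := 176) (b := 0) (by norm_num) le_rfl (show (0 : ℝ) < ε / 20 by positivity),
    tendsto_natCast_atTop_atTop.eventually_ge_atTop (12 / ε)] with n hl hn1 hlog hbig
  have hnR : (1 : ℝ) ≤ n := by exact_mod_cast hn1
  have hb : (12 : ℝ) ≤ ε * n := by rwa [div_le_iff₀ hε, mul_comm] at hbig
  rw [add_zero] at hlog
  have hR := log_sharpRatio_le hn1
  have hpos : 0 < ((M0 n : ℚ) : ℝ) := by exact_mod_cast M0_pos n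
  rw [← Real.exp_log hpos, Real.exp_le_exp, cast_M0]
  have hdpos : (0 : ℝ) < ((Nat.lcmUpto (41 * n) : ℕ) : ℝ) := by exact_mod_cast Nat.lcmUpto_pos _
  have hratio : 0 < ((sharpNormaliser (bRecord n) : ℚ) : ℝ) * ((sharpNormaliser (bRecord' n) : ℚ) : ℝ) /
      |(rhoOf (aRec n) : ℝ)| := by
    have := sharpNormaliser_pos (bRecord n); have := sharpNormaliser_pos (bRecord' n)
    have h3 : 0 < |(rhoOf (aRec n) : ℝ)| := by
      rw [abs_pos]; exact_mod_cast rhoOf_aRec_ne_zero n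
    positivity
  rw [Real.log_mul (by positivity) hratio.ne', Real.log_pow]
  push_cast
  nlinarith

/-- **THE FIRST HYPOTHESIS-FREE EXPONENT of the record approximations (baseline, no prime removed).**  For every
`γ ≤ 0.2499`, eventually `|ζ(5) − P_n/Q(a·n)| < 1/q_n^γ` with the integers `p_n = M0 n·P_n`, `q_n = M0 n·|Q(a·n)| ≥ 1`.
Arithmetic: `0.2499·(381.5332 + 85.08768884) < 85.08768883 + 31.5452`.  No irrationality content (`γ < 1`); the value
is raised by the window files of this series. -/
theorem record_exponent_baseline {γ : ℝ} (hγ0 : 0 ≤ γ) (hγ : γ ≤ 2499 / 10 ^ 4) :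
    ∀ᶠ n : ℕ in atTop, ∃ p : ℤ, ∃ q : ℕ, 1 ≤ q ∧ (q : ℚ) = M0 n * |(recordQ n : ℚ)| ∧ (p : ℚ) = M0 n * recordP n ∧
      |zetaValue 5 - (recordP n : ℝ) / (recordQ n : ℝ)| < 1 / (q : ℝ) ^ γ := by
  refine record_exponent_rat (lam := 3815232 / 10000 + 1 / 100) M0 ?_ hγ0 (by nlinarith)
  filter_upwards [eventually_M0_le_exp (show (0 : ℝ) < 1 / 100 by norm_num), eventually_ge_atTop 1] with n hn hn1
  exact ⟨M0_pos n, M0_mul_recordP_int hn1, M0_mul_recordQ_int hn1, hn⟩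

end Summit.KontsevichZagierPeriods.Zeta5Search.RecordRay
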